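import Mathlib
import Literature.Combinatorics.Kakeya.Tao2005UnitSphere
import Literature.Combinatorics.Kakeya.FiniteFieldKakeya
import HarnessLib

/-!
# The joints theorem over an arbitrary field (Tao 2014, Theorem 3.3 — Guth–Katz, Kaplan–Sharir–Shustin, Quilodrán)

Topic `Literature/Combinatorics/Kakeya`.  Everything in this file is PROVED (no named fact, no
`sorry`).  Companion to the finite-field Kakeya files of this directory (Dvir's theorem,
`FiniteFieldKakeya`; the Kakeya maximal and Nikodym bounds, `KakeyaMaximalConjecture`): the other
classical application of Dvir's polynomial method, the **joints problem** — introduced as a discrete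
model of the Kakeya problem and settled by Guth and Katz (*Algebraic methods in discrete analogs of
the Kakeya problem*, Adv. Math. 225 (2010)) in `ℝ³` and by Kaplan–Sharir–Shustin and Quilodrán in
`ℝⁿ` — in the arbitrary-field form printed in

T. Tao, *Algebraic combinatorial geometry: the polynomial method in arithmetic combinatorics,
incidence combinatorics, and number theory*, EMS Surv. Math. Sci. **1** (2014), no. 1, 1–46
(doi:10.4171/EMSS/1; arXiv:1310.6482, v5 = "final revision", whose numbering and pages are used
below), §3 "Smoothness", verbatim (arXiv v5, p. 14):

> **Theorem 3.3 (Joints conjecture).** Let `F` be a field, let `n ≥ 2`, and let `L` be a set of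
> `N` lines in `Fⁿ`. Define a *joint* to be a point `p` in `Fⁿ` with the property that there are
> `n` lines in `L` passing through `p` which are not coplanar (or more precisely, cohyperplanar) in
> the sense that they do not all lie in a hyperplane. Then the number of joints is at most
> `n N^{n/(n−1)}`.

("As with the Kakeya conjecture over finite fields, the only known proofs of the full conjecture
proceed via the polynomial method; this was first done in the `n = 3` case in [Guth–Katz], and for
general `n` in [Quilodrán], [Kaplan–Sharir–Shustin].")  Lines are, as in §1 of the survey, the sets
`ℓ_{x₀,v₀} = {x₀ + t v₀ : t ∈ F}` with `v₀ ≠ 0`.  The tools, verbatim: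

> **Lemma 1.4 (Interpolation).** Let `F` be a field, let `n ≥ 1` be an integer, and `d ≥ 0`. If
> `E ⊂ Fⁿ` has cardinality less than `C(d+n, n) := (d+n) ⋯ (d+1)/n!`, then there exists a non-zero
> polynomial `P ∈ F[x₁, …, xₙ]` of degree at most `d` such that `E ⊂ Z(P)[F]`.
>
> **Lemma 1.6 (Dichotomy).** Let `F` be a field, let `n ≥ 1` be an integer, let `Z(P)` be a
> (geometric) hypersurface of degree at most `d`, and let `ℓ` be a (geometric) line. Then either `ℓ`
> is (geometrically) contained in `Z(P)`, or else `Z(P)[F] ∩ ℓ[F]` has cardinality at most `d`.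
>
> **Lemma 3.2.** Let `Z(P)` be a hypersurface in `F̄ⁿ` for some `P ∈ F[x₁, …, xₙ]`, and let `p` be
> a smooth `F`-point. Let `ℓ_{x₀,v₀}` be a line which is geometrically contained in `Z(P)` and
> passes through `p`. Then `v₀ · ∇P(p) = 0`.

and the printed proof of Theorem 3.3 ("We use an argument from [Quilodrán]"): iteratively delete a
line of `L′` passing through `d` or fewer points of `J′` together with those points; if `J′` ends
up empty then `|J| ≤ d|L|`; otherwise, if `|J| ≤ dⁿ/n! < C(d+n, n)`, take `P` of minimal degree
with `J′ ⊂ Z(P)` — "this forces `P` to be square-free … This in turn implies that `∇P` does not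
vanish identically, since this can only occur if `F` has a positive characteristic `p` and `P` is a
linear combination of the monomials `x^{i₁} … x^{iₙ}` with all `i₁, …, iₙ` divisible by the
characteristic `p`, and then by using the Frobenius endomorphism `x ↦ x^p` we see that `P = Q^p`
for some polynomial `Q`, contradicting the square-free nature of `P`"; every line of `L′` meets
`Z(P)` in more than `d` points hence lies in `Z(P)` (Lemma 1.6), so at each `p ∈ J′` the `n`
non-cohyperplanar directions are orthogonal to `∇P(p)` (Lemma 3.2), forcing `∇P(p) = 0`; "Setting
`D^{e_j} P` to be one of the non-vanishing derivatives of `P`, we conclude that `p ∈ Z(D^{e_j} P)`,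
contradicting the minimality of `P`. Summarising … for any `d`, one of the statements `|J| ≤ d|L|`
and `|J| > dⁿ/n!` must hold", whence `|J| ≤ (n!)^{1/n} |J|^{1/n} |L|`, "and the claim follows
(using the trivial bound `n! ≤ n^{n−1}`)."

## Setting and definitions

`F` is any field, the ambient space is `Fin n → F`, lines are the sets
`Tao2005UnitSphere.line F x v = {x + t v : t ∈ F}`:
* `IsLine ℓ` — `ℓ = line F x v` for some `x` and some `v ≠ 0` (set-valued lines over an arbitrary
  field; `Planebrush.IsLine` is the `Finset` version over a finite field);
* `IsJoint L p` — for a finite family `L : Finset (Set (Fin n → F))`: there are `n` lines of `L`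
  through `p` with linearly independent direction vectors; **`isJoint_iff`** proves that this is the
  printed definition read literally ("`n` lines in `L` passing through `p` which do not all lie in
  a hyperplane", a hyperplane being a translate `x + W`, `dim W = n − 1`,
  `Tao2005UnitSphere.translate`);
* `joints L` — the set of joints; `joints_finite` — it is finite when `n ≥ 2` (two of the lines at
  a joint are distinct and meet only there).

## What is proved

* `ncard_joints_le` — **Theorem 3.3 exactly as printed: for every field `F`, every `n ≥ 2` and
  every finite family `L`, `|joints L| ≤ n · |L|^{n/(n−1)}`** (over `ℝ`);
* `ncard_joints_pow_le` — the integer form `|joints L|^{n−1} ≤ n! · |L|ⁿ` which the printed proof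
  yields before its last sentence (`n! ≤ n^{n−1}`, `factorial_le_pow_pred`);
* `ncard_joints_pow_le_of_isAlgClosed`, `ncard_joints_le_card_mul` (the deletion argument:
  `|J| < C(d+n, n) ⟹ |J| ≤ d |L|`), `exists_mem_ncard_inter_le` (the polynomial argument: some line
  carries at most `d` of the joints) — the printed proof, over an algebraically closed field;
* the tools: `sum_mul_eval_pderiv_eq_zero` (Lemma 3.2, from the chain rule
  `derivative_aeval_lineSubst`), `eval_pderiv_eq_zero_of_linearIndependent` (`∇P(p) = 0` at a
  joint), `totalDegree_pderiv_lt`, `natCast_eq_zero_of_pderiv_eq_zero` and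
  `exists_pow_eq_of_dvd_exponents` / `exists_totalDegree_lt_of_pderiv_eq_zero` (the Frobenius
  step `P = Q^p`); Lemma 1.4 is `FiniteFieldKakeya.exists_mvPolynomial_eval_eq_zero` and Lemma 1.6
  is `Extremal.aeval_line_eq_zero_of_totalDegree_lt_card`, both already in the tree;
* section `Sharpness` — the sentence after Theorem 3.3, "The bound here is sharp except for the
  constant factor of `n`, as can be seen by considering the lines in the coordinate directions
  `e_1, …, e_n` passing through a Cartesian product `A_1 × … × A_n` …": the family `gridLines A`
  of these lines has at most `∑ᵢ ∏_{j ≠ i} |A_j|` members (`card_gridLines_le`), its joints are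
  exactly the grid points (`joints_gridLines`, `n ≥ 2`), and for `|A_1| = ⋯ = |A_n| = m` this is
  `N ≤ n m^{n−1}` lines with `mⁿ` joints, `Nⁿ ≤ nⁿ |J|^{n−1}` (`card_gridLines_pow_le`,
  `rpow_card_gridLines_le`).

No hypothesis "every member of `L` is a line" is needed: a member of `L` that is not a line is
never one of the `n` lines at a joint, so extra members only weaken the bound; for a set of `N`
lines the statements are literally the printed ones.

## Proof architecture, and the one deviation

As printed, with the bookkeeping made explicit: the deletion algorithm is an induction on `|L|`
with the threshold `d` fixed (`ncard_joints_le_card_mul`: a joint not on the deleted line is a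
joint of the remaining family); `d` is taken to be the least integer with `C(d+n, n) > |J|`, so
that `dⁿ ≤ d(d+1)⋯(d+n−1) = n!·C(d−1+n, n) ≤ n!·|J|` replaces "`d := (n!)^{1/n} |J|^{1/n}`"; the
minimal-degree `P` need not be observed to be square-free — minimality is contradicted directly by
`Q` (`deg Q ≤ deg P / p < deg P`, same zero set).  **Deviation:** the sentence "`P = Q^p` for some
polynomial `Q`" takes `p`-th roots of the coefficients of `P`, which exist when `F` is perfect; we
therefore run the whole polynomial argument over an algebraic closure `K` of `F`
(`IsAlgClosed.exists_pow_nat_eq`) and deduce the theorem for `F` itself by extension of scalars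
(`ncard_joints_pow_le`: an `F`-line spans a `K`-line, joints of `L` map injectively to joints of
the lifted family because linear independence is the nonvanishing of a determinant, and the lifted
family has at most `|L|` members) — for `F` perfect (e.g. finite, or of characteristic zero) this
detour is unnecessary but harmless.

## Not in this file

The variants of [Elekes–Kaplan–Sharir] mentioned after Theorem 3.3; later refinements
(Carbery–Iliopoulou's joints with multiplicities, Zhang's multijoints, Yu–Zhao's sharp constant).

## References
* [Tao2014PolynomialMethodSurvey] T. Tao, EMS Surv. Math. Sci. 1 (2014), no. 1, 1–46,
  doi:10.4171/EMSS/1, arXiv:1310.6482v5 — Theorem 3.3 (p. 14) and its proof (pp. 14–15),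
  Lemma 3.2 (p. 14), Lemma 1.4 and Lemma 1.6 (§1).
* L. Guth, N. H. Katz, Adv. Math. 225 (2010), no. 5, 2828–2839 (the case `n = 3`, `F = ℝ`);
  H. Kaplan, M. Sharir, E. Shustin, Discrete Comput. Geom. 44 (2010), no. 4, 838–843 and
  R. Quilodrán, SIAM J. Discrete Math. 23 (2009/10), no. 4, 2211–2213 (`ℝⁿ`) — cited through the
  survey.
-/

namespace Literature.Combinatorics.Kakeya

namespace Joints

open MvPolynomial Finset Module Tao2005UnitSphere

section Lines

variable {F : Type*} [Field F] {n : ℕ}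

/-- `ℓ ⊆ Fⁿ` **is a line**: `ℓ = {x + t v : t ∈ F}` for some point `x` and some nonzero direction
vector `v` (Tao, §1: "`ℓ_{x₀,v₀} := {x₀ + t v₀ : t ∈ F}` … `v₀ ∈ Fⁿ ∖ {0}`"; the set-valued,
arbitrary-field version of `Planebrush.IsLine`, which is about finite point sets over a finite
field). [cite: Tao2014PolynomialMethodSurvey, §1 (lines `ℓ_{x₀,v₀}`), Thm 3.3] -/
def IsLine (ℓ : Set (Fin n → F)) : Prop :=
  ∃ x v : Fin n → F, v ≠ 0 ∧ ℓ = line F x v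

/-- `line F x v` is a line when `v ≠ 0`. [folklore] -/
private theorem isLine_line (x : Fin n → F) {v : Fin n → F} (hv : v ≠ 0) : IsLine (line F x v) :=
  ⟨x, v, hv, rfl⟩

/-- A line can be re-based at any of its points. [folklore] -/
private theorem IsLine.exists_eq_line {ℓ : Set (Fin n → F)} (hℓ : IsLine ℓ) {p : Fin n → F}
    (hp : p ∈ ℓ) : ∃ v : Fin n → F, v ≠ 0 ∧ ℓ = line F p v := by
  obtain ⟨x, v, hv, rfl⟩ := hℓ
  exact ⟨v, hv, (line_eq_of_mem hp).symm⟩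

/-- A line is determined by two of its points: a line through `x ≠ y` is `{x + t (y − x)}`.
[folklore] -/
private theorem IsLine.eq_line_sub {ℓ : Set (Fin n → F)} (hℓ : IsLine ℓ) {x y : Fin n → F} (hx : x ∈ ℓ)
    (hy : y ∈ ℓ) (hxy : x ≠ y) : ℓ = line F x (y - x) := by
  obtain ⟨v, hv, rfl⟩ := hℓ.exists_eq_line hx
  obtain ⟨t, ht⟩ := mem_line_iff.1 hy
  have ht0 : t ≠ 0 := by
    rintro rfl
    exact hxy (by simpa using ht)
  rw [← ht, add_sub_cancel_left, line_smul x v ht0]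

/-- Two distinct lines meet in at most one point. [folklore] -/
private theorem subsingleton_inter {ℓ ℓ' : Set (Fin n → F)} (hℓ : IsLine ℓ) (hℓ' : IsLine ℓ')
    (hne : ℓ ≠ ℓ') : (ℓ ∩ ℓ').Subsingleton := by
  intro x hx y hy
  by_contra hxy
  exact hne ((hℓ.eq_line_sub hx.1 hy.1 hxy).trans (hℓ'.eq_line_sub hx.2 hy.2 hxy).symm)

end Lines

section JointsDef

variable {F : Type*} [Field F] {n : ℕ}

/-- **`p` is a joint of the family `L`** (Tao, Thm 3.3: "a point `p` in `Fⁿ` with the property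
that there are `n` lines in `L` passing through `p` which are not coplanar (or more precisely,
cohyperplanar) in the sense that they do not all lie in a hyperplane"), in the equivalent form
used by the proof: there are `n` lines of `L` through `p` whose direction vectors are linearly
independent (`isJoint_iff` is the literal reading). [cite: Tao2014PolynomialMethodSurvey, Thm 3.3
(arXiv:1310.6482v5 p. 14)] -/
def IsJoint (L : Finset (Set (Fin n → F))) (p : Fin n → F) : Prop :=
  ∃ v : Fin n → Fin n → F, LinearIndependent F v ∧ ∀ i, line F p (v i) ∈ L

/-- **The set of joints** of the family `L`. [cite: Tao2014PolynomialMethodSurvey, Thm 3.3] -/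
def joints (L : Finset (Set (Fin n → F))) : Set (Fin n → F) := {p | IsJoint L p}

/-- Membership in `joints`. [folklore] -/
private theorem mem_joints_iff {L : Finset (Set (Fin n → F))} {p : Fin n → F} :
    p ∈ joints L ↔ IsJoint L p :=
  Iff.rfl

/-- A joint of a subfamily is a joint of the family. [folklore] -/
private theorem IsJoint.mono {L L' : Finset (Set (Fin n → F))} (h : L ⊆ L') {p : Fin n → F}
    (hp : IsJoint L p) : IsJoint L' p := by
  obtain ⟨v, hv, hL⟩ := hp
  exact ⟨v, hv, fun i => h (hL i)⟩

/-- `joints` is monotone in the family. [folklore] -/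
private theorem joints_mono {L L' : Finset (Set (Fin n → F))} (h : L ⊆ L') : joints L ⊆ joints L' :=
  fun _ hp => IsJoint.mono h hp

/-- A joint not lying on `ℓ` stays a joint after `ℓ` is removed from the family. [folklore] -/
private theorem IsJoint.erase [DecidableEq (Set (Fin n → F))] {L : Finset (Set (Fin n → F))}
    {p : Fin n → F} (hp : IsJoint L p) {ℓ : Set (Fin n → F)} (hpℓ : p ∉ ℓ) :
    IsJoint (L.erase ℓ) p := by
  obtain ⟨v, hv, hL⟩ := hp
  refine ⟨v, hv, fun i => Finset.mem_erase.2 ⟨?_, hL i⟩⟩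
  rintro h
  exact hpℓ (h ▸ mem_line_self p (v i))

/-- In a linearly independent family two distinct members are not proportional. [folklore] -/
private theorem ne_smul_of_linearIndependent {v : Fin n → Fin n → F} (hv : LinearIndependent F v)
    {i j : Fin n} (hij : i ≠ j) (c : F) : v j ≠ c • v i := by
  intro h
  have hsum : ∑ k ∈ ({i, j} : Finset (Fin n)), (fun k => if k = j then (-1 : F) else c) k • v k
      = 0 := by
    rw [Finset.sum_pair hij]
    simp [hij, h]
  have := linearIndependent_iff'.1 hv {i, j} _ hsum j (by simp)
  simp at this

/-- Two of the `n` lines witnessing a joint are distinct. [folklore] -/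
private theorem line_ne_line_of_linearIndependent {v : Fin n → Fin n → F} (hv : LinearIndependent F v)
    (p : Fin n → F) {i j : Fin n} (hij : i ≠ j) : line F p (v i) ≠ line F p (v j) := by
  intro h
  obtain ⟨c, -, hc⟩ := exists_eq_smul_of_line_eq (hv.ne_zero j) h
  exact ne_smul_of_linearIndependent hv hij c hc

/-- **The joints of a finite family form a finite set** (`n ≥ 2`; "the number of joints" of the
printed statement): each joint lies on two distinct lines of the family, which meet only there.
[cite: Tao2014PolynomialMethodSurvey, Thm 3.3 (arXiv:1310.6482v5 p. 14, "the number of joints")] -/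
theorem joints_finite (hn : 2 ≤ n) (L : Finset (Set (Fin n → F))) : (joints L).Finite := by
  let S : Set (Fin n → F) := ⋃ ℓ ∈ L, ⋃ ℓ' ∈ L,
    {x | IsLine ℓ ∧ IsLine ℓ' ∧ ℓ ≠ ℓ' ∧ x ∈ ℓ ∧ x ∈ ℓ'}
  have hS : S.Finite := by
    refine Set.Finite.biUnion L.finite_toSet fun ℓ _ => ?_
    refine Set.Finite.biUnion L.finite_toSet fun ℓ' _ => ?_
    refine Set.Subsingleton.finite ?_
    rintro x ⟨hℓ, hℓ', hne, hx, hx'⟩ y ⟨-, -, -, hy, hy'⟩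
    exact subsingleton_inter hℓ hℓ' hne ⟨hx, hx'⟩ ⟨hy, hy'⟩
  refine hS.subset fun p hp => ?_
  obtain ⟨v, hv, hL⟩ := hp
  have h01 : (⟨0, by omega⟩ : Fin n) ≠ ⟨1, by omega⟩ := by simp
  refine Set.mem_iUnion₂.2 ⟨line F p (v ⟨0, by omega⟩), hL _, Set.mem_iUnion₂.2
    ⟨line F p (v ⟨1, by omega⟩), hL _, isLine_line p (hv.ne_zero _), isLine_line p (hv.ne_zero _),
      line_ne_line_of_linearIndependent hv p h01, mem_line_self _ _, mem_line_self _ _⟩⟩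

/-- **The definition of a joint, read literally** (Tao, Thm 3.3): `p` is a joint of `L` iff there
are `n` lines of `L` passing through `p` which do not all lie in a(n affine) hyperplane `x + W`,
`dim W = n − 1` (`Tao2005UnitSphere.translate`).  (`n` lines through `p` lie in a common hyperplane
iff their direction vectors lie in a common linear hyperplane iff these `n` vectors are linearly
dependent.) [cite: Tao2014PolynomialMethodSurvey, Thm 3.3 (arXiv:1310.6482v5 p. 14)] -/
theorem isJoint_iff {L : Finset (Set (Fin n → F))} {p : Fin n → F} :
    IsJoint L p ↔ ∃ ℓ : Fin n → Set (Fin n → F), (∀ i, ℓ i ∈ L) ∧ (∀ i, IsLine (ℓ i)) ∧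
      (∀ i, p ∈ ℓ i) ∧ ∀ (x : Fin n → F) (W : Submodule F (Fin n → F)),
        Module.finrank F W + 1 = n → ∃ i, ¬ (ℓ i ⊆ translate x W) := by
  constructor
  · rintro ⟨v, hv, hL⟩
    refine ⟨fun i => line F p (v i), hL, fun i => isLine_line p (hv.ne_zero i),
      fun i => mem_line_self p (v i), fun x W hW => ?_⟩
    by_contra! hsub
    have hvW : ∀ i, v i ∈ W := fun i => mem_of_line_subset (hsub i)
    have hspan : Submodule.span F (Set.range v) ≤ W :=
      Submodule.span_le.2 (Set.range_subset_iff.2 hvW)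
    have hle := Submodule.finrank_mono hspan
    rw [finrank_span_eq_card hv, Fintype.card_fin] at hle
    omega
  · rintro ⟨ℓ, hL, hline, hp, hhyp⟩
    choose w hw0 hw using fun i => (hline i).exists_eq_line (hp i)
    refine ⟨w, ?_, fun i => hw i ▸ hL i⟩
    by_contra hdep
    have hlt : Submodule.span F (Set.range w) < ⊤ := by
      rw [lt_top_iff_ne_top]
      intro htop
      apply hdep
      rw [linearIndependent_iff_card_eq_finrank_span, Fintype.card_fin, Set.finrank, htop,
        finrank_top, Module.finrank_fintype_fun_eq_card, Fintype.card_fin]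
    obtain ⟨f, hf0, hf⟩ := Submodule.exists_dual_map_eq_bot_of_lt_top hlt inferInstance
    have hker : ∀ i, w i ∈ LinearMap.ker f := by
      intro i
      rw [LinearMap.mem_ker]
      have hmem : f (w i) ∈ (Submodule.span F (Set.range w)).map f :=
        Submodule.mem_map_of_mem (Submodule.subset_span (Set.mem_range_self i))
      rw [hf] at hmem
      simpa using hmem
    have hdim : Module.finrank F (LinearMap.ker f) + 1 = n := by
      rw [Module.Dual.finrank_ker_add_one_of_ne_zero hf0, Module.finrank_fintype_fun_eq_card,
        Fintype.card_fin]
    obtain ⟨i, hi⟩ := hhyp p (LinearMap.ker f) hdim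
    exact hi (hw i ▸ line_subset_translate (self_mem_translate p _) (hker i))

end JointsDef

section Calculus

variable {F : Type*} [Field F] {n : ℕ}

/-- The substitution `Xᵢ ↦ aᵢ + vᵢ t`: `aeval (lineSubst a v) P ∈ F[t]` is the restriction
`t ↦ P(a + t v)` of `P` to the line through `a` with direction `v` (the parametrisation used in
`Literature.Combinatorics.Extremal.LowDegreeSurfaceThroughLines`). [folklore] -/
noncomputable abbrev lineSubst (a v : Fin n → F) : Fin n → Polynomial F :=
  fun i => Polynomial.C (a i) + Polynomial.C (v i) * Polynomial.X

/-- Evaluating the restriction at `t` is evaluating `P` at `a + t v`. [folklore] -/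
private theorem eval_aeval_lineSubst (a v : Fin n → F) (P : MvPolynomial (Fin n) F) (t : F) :
    (aeval (lineSubst a v) P).eval t = eval (a + t • v) P :=
  Extremal.eval_aeval_line a v P t

/-- **Chain rule along a line**: `d/dt P(a + t v) = ∑ᵢ vᵢ · (∂ᵢ P)(a + t v)` as polynomials in `t`
(proof of Lemma 3.2: "this derivative can be computed to equal `v₀ · ∇P(p)`"). [folklore]
[cite: Tao2014PolynomialMethodSurvey, Lemma 3.2 (proof, arXiv:1310.6482v5 p. 14)] -/
theorem derivative_aeval_lineSubst (a v : Fin n → F) (P : MvPolynomial (Fin n) F) :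
    Polynomial.derivative (aeval (lineSubst a v) P) =
      ∑ i, Polynomial.C (v i) * aeval (lineSubst a v) (pderiv i P) := by
  induction P using MvPolynomial.induction_on with
  | C c => simp
  | add p q hp hq =>
    simp only [map_add, hp, hq, mul_add, Finset.sum_add_distrib]
  | mul_X p j hp =>
    set ℓj := Polynomial.C (a j) + Polynomial.C (v j) * Polynomial.X with hℓj
    have hX : aeval (lineSubst a v) (X j : MvPolynomial (Fin n) F) = ℓj := aeval_X _ j
    have hd : Polynomial.derivative ℓj = Polynomial.C (v j) := by simp [hℓj]
    have hs : ∀ i, aeval (lineSubst a v) (pderiv i (p * X j)) =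
        aeval (lineSubst a v) (pderiv i p) * ℓj +
          (if i = j then aeval (lineSubst a v) p else 0) := by
      intro i
      rw [pderiv_mul, map_add, map_mul, hX, pderiv_X]
      by_cases hij : i = j
      · subst hij
        simp
      · simp [hij]
    rw [map_mul, hX, Polynomial.derivative_mul, hd, hp]
    simp_rw [hs, mul_add, Finset.sum_add_distrib, Finset.sum_mul, mul_assoc, mul_ite, mul_zero,
      Finset.sum_ite_eq', Finset.mem_univ, if_true]
    ring

/-- **Tao's Lemma 3.2** ("`v₀ · ∇P(p) = 0`" for a line `ℓ_{x₀,v₀} ⊆ Z(P)` through `p`): if the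
restriction of `P` to the line `t ↦ a + t v` is the zero polynomial, then the derivative of `P`
along the line vanishes at each of its points, `∑ᵢ vᵢ (∂ᵢ P)(a + t v) = 0`. (Printed for a smooth
point and a line "geometrically contained in `Z(P)`"; over any field the hypothesis we use — the
restriction is the zero polynomial — is what Lemma 1.6 provides.)
[cite: Tao2014PolynomialMethodSurvey, Lemma 3.2 (arXiv:1310.6482v5 p. 14)] -/
theorem sum_mul_eval_pderiv_eq_zero {a v : Fin n → F} {P : MvPolynomial (Fin n) F}
    (h : aeval (lineSubst a v) P = 0) (t : F) :
    ∑ i, v i * eval (a + t • v) (pderiv i P) = 0 := by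
  have hd := derivative_aeval_lineSubst a v P
  rw [h, Polynomial.derivative_zero] at hd
  have := congrArg (Polynomial.eval t) hd.symm
  simpa [Polynomial.eval_finsetSum, eval_aeval_lineSubst] using this

/-- If `∑ᵢ vⱼᵢ gᵢ = 0` for the `n` members `vⱼ` of a linearly independent family of vectors of
`Fⁿ`, then `g = 0` ("the directions `v₁, …, vₙ` are all orthogonal to `∇P(p)`, but this is not
possible …" unless `∇P(p) = 0`). [folklore] -/
private theorem eq_zero_of_forall_sum_mul_eq_zero {v : Fin n → Fin n → F} (hv : LinearIndependent F v)
    {g : Fin n → F} (h : ∀ j, ∑ i, v j i * g i = 0) : g = 0 := by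
  have hu : IsUnit (Matrix.of v) := Matrix.linearIndependent_rows_iff_isUnit.1 hv
  have hdet : (Matrix.of v).det ≠ 0 := ((Matrix.isUnit_iff_isUnit_det _).1 hu).ne_zero
  exact Matrix.eq_zero_of_mulVec_eq_zero hdet (funext fun j => h j)

/-- **The gradient vanishes at a joint of lines contained in `Z(P)`**: if the restrictions of `P`
to `n` lines through `p` with linearly independent directions are all zero, then
`(∂ᵢ P)(p) = 0` for every `i` ("all the points in `J′` are singular points of `Z(P)`").
[cite: Tao2014PolynomialMethodSurvey, Thm 3.3 (proof, arXiv:1310.6482v5 pp. 14–15)] -/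
theorem eval_pderiv_eq_zero_of_linearIndependent {v : Fin n → Fin n → F}
    (hv : LinearIndependent F v) {p : Fin n → F} {P : MvPolynomial (Fin n) F}
    (h : ∀ j, aeval (lineSubst p (v j)) P = 0) (i : Fin n) : eval p (pderiv i P) = 0 := by
  have h0 : ∀ j, ∑ i, v j i * eval p (pderiv i P) = 0 := fun j => by
    simpa using sum_mul_eval_pderiv_eq_zero (h j) 0
  exact congrFun (eq_zero_of_forall_sum_mul_eq_zero hv h0) i

end Calculus

section Derivatives

variable {R : Type*} [CommSemiring R] {σ : Type*}

/-- The degree of `m + eᵢ` is the degree of `m` plus one. [folklore] -/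
private theorem sum_add_single_one (m : σ →₀ ℕ) (i : σ) :
    ((m + Finsupp.single i 1).sum fun _ e => e) = (m.sum fun _ e => e) + 1 := by
  rw [Finsupp.sum_add_index' (fun _ => rfl) (fun _ _ _ => rfl), Finsupp.sum_single_index rfl]

/-- **A nonzero partial derivative has smaller total degree** (the derivatives `D^{e_j} P` of the
printed proof have degree `< deg P`, which is what "contradicting the minimality of `P`" uses).
[folklore] [cite: Tao2014PolynomialMethodSurvey, Thm 3.3 (proof, arXiv:1310.6482v5 p. 15)] -/
theorem totalDegree_pderiv_lt {P : MvPolynomial σ R} {i : σ} (h : pderiv i P ≠ 0) :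
    (pderiv i P).totalDegree < P.totalDegree := by
  classical
  have key : ∀ m ∈ (pderiv i P).support, (m.sum fun _ e => e) + 1 ≤ P.totalDegree := by
    intro m hm
    have hc : coeff (m + Finsupp.single i 1) P ≠ 0 := by
      have := mem_support_iff.1 hm
      rw [coeff_pderiv] at this
      exact left_ne_zero_of_mul this
    rw [← sum_add_single_one m i]
    exact le_totalDegree (mem_support_iff.2 hc)
  obtain ⟨m₀, hm₀⟩ := ne_zero_iff.1 h
  have hpos : 0 < P.totalDegree := lt_of_lt_of_le (Nat.succ_pos _) (key m₀ (mem_support_iff.2 hm₀))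
  rw [totalDegree, Finset.sup_lt_iff hpos]
  exact fun m hm => key m hm

/-- **If `∂ᵢ P = 0` then every monomial of `P` has `i`-exponent `≡ 0` in `R`** (so `= 0` in
characteristic zero and divisible by `p` in characteristic `p`: "`∇P` … vanish[es] identically …
only … if `F` has a positive characteristic `p` and `P` is a linear combination of the monomials
`x^{i₁} ⋯ x^{iₙ}` with all `i₁, …, iₙ` divisible by the characteristic `p`"). [folklore]
[cite: Tao2014PolynomialMethodSurvey, Thm 3.3 (proof, arXiv:1310.6482v5 p. 15)] -/
theorem natCast_eq_zero_of_pderiv_eq_zero [NoZeroDivisors R] {P : MvPolynomial σ R} {i : σ}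
    (h : pderiv i P = 0) {m : σ →₀ ℕ} (hm : m ∈ P.support) : (m i : R) = 0 := by
  classical
  by_cases hmi : m i = 0
  · simp [hmi]
  have key := coeff_pderiv (i := i) P (m - Finsupp.single i 1)
  rw [h, coeff_zero, Finsupp.sub_add_single_one_cancel hmi, Finsupp.tsub_apply,
    Finsupp.single_eq_same] at key
  have hcast : ((m i - 1 : ℕ) : R) + 1 = (m i : R) := by
    rw [← Nat.cast_add_one, Nat.sub_add_cancel (Nat.one_le_iff_ne_zero.2 hmi)]
  rw [hcast] at key
  exact (mul_eq_zero.1 key.symm).resolve_left (mem_support_iff.1 hm)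

end Derivatives

section Frobenius

variable {K : Type*} [Field K] {σ : Type*}

/-- **`p`-th roots of polynomials with all exponents divisible by `p`** ("by using the Frobenius
endomorphism `x ↦ x^p` we see that `P = Q^p` for some polynomial `Q`", arXiv v5 p. 15): over an
algebraically closed field of characteristic `p`, a polynomial whose monomials have all their
exponents divisible by `p` is a `p`-th power, of a polynomial of total degree `≤ deg P / p`.
[cite: Tao2014PolynomialMethodSurvey, Thm 3.3 (proof, arXiv:1310.6482v5 p. 15)] -/
theorem exists_pow_eq_of_dvd_exponents [IsAlgClosed K] {p : ℕ} [Fact p.Prime] [CharP K p]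
    {P : MvPolynomial σ K} (h : ∀ m ∈ P.support, ∀ i, p ∣ m i) :
    ∃ Q : MvPolynomial σ K, Q ^ p = P ∧ Q.totalDegree ≤ P.totalDegree / p := by
  classical
  have hp : p.Prime := Fact.out
  -- `p`-th roots of the coefficients
  choose r hr using fun c : K => IsAlgClosed.exists_pow_nat_eq c hp.pos
  -- the exponent vectors divided by `p`
  let dv : (σ →₀ ℕ) → (σ →₀ ℕ) := fun m => m.mapRange (· / p) (Nat.zero_div p)
  have hdv : ∀ m ∈ P.support, p • dv m = m := by
    intro m hm
    ext i
    simp only [dv, Finsupp.smul_apply, Finsupp.mapRange_apply, smul_eq_mul]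
    exact Nat.mul_div_cancel' (h m hm i)
  refine ⟨∑ m ∈ P.support, monomial (dv m) (r (coeff m P)), ?_, ?_⟩
  · calc (∑ m ∈ P.support, monomial (dv m) (r (coeff m P))) ^ p
        = frobenius (MvPolynomial σ K) p (∑ m ∈ P.support, monomial (dv m) (r (coeff m P))) :=
          (frobenius_def p _).symm
      _ = ∑ m ∈ P.support, monomial m (coeff m P) := by
          rw [map_sum]
          refine Finset.sum_congr rfl fun m hm => ?_
          rw [frobenius_def, monomial_pow, hdv m hm, hr]
      _ = P := (as_sum P).symm
  · refine totalDegree_finsetSum_le fun m hm => (totalDegree_monomial_le _ _).trans ?_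
    have hm_deg : (m.sum fun _ e => e) ≤ P.totalDegree := le_totalDegree hm
    have hmul : p * ((dv m).sum fun _ ↦ id) = m.sum fun _ e => e := by
      conv_rhs => rw [← hdv m hm]
      rw [Finsupp.sum_smul_index' (fun _ => rfl), Finsupp.sum, Finsupp.sum, Finset.mul_sum]
      rfl
    refine (Nat.le_div_iff_mul_le hp.pos).2 ?_
    rw [mul_comm, hmul]
    exact hm_deg

/-- **No nonconstant polynomial over an algebraically closed field has all its first-order partial
derivatives zero without being a `p`-th power of a polynomial of smaller degree with the same
zeros**: the step "this in turn implies that `∇P` does not vanish identically, since this can only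
occur if … `P = Q^p` …, contradicting the [minimality] of `P`" of the printed proof, in the form
used below.  In characteristic zero the hypothesis forces `P` to be constant, so the conclusion is
vacuous. [cite: Tao2014PolynomialMethodSurvey, Thm 3.3 (proof, arXiv:1310.6482v5 p. 15)] -/
theorem exists_totalDegree_lt_of_pderiv_eq_zero [IsAlgClosed K] {P : MvPolynomial σ K}
    (hP : P ≠ 0) (hdeg : 0 < P.totalDegree) (h : ∀ i, pderiv i P = 0) :
    ∃ Q : MvPolynomial σ K, Q ≠ 0 ∧ Q.totalDegree < P.totalDegree ∧
      ∀ x : σ → K, eval x P = 0 → eval x Q = 0 := by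
  classical
  rcases CharP.exists' K with hK | ⟨p, hp, hKp⟩
  · -- characteristic zero: every exponent vanishes, so `P` is constant
    exfalso
    have hsupp : ∀ m ∈ P.support, m = 0 := by
      intro m hm
      ext i
      exact_mod_cast natCast_eq_zero_of_pderiv_eq_zero (h i) hm
    have : P.totalDegree = 0 := by
      rw [totalDegree]
      refine le_antisymm (Finset.sup_le fun m hm => ?_) (Nat.zero_le _)
      rw [hsupp m hm]
      simp
    omega
  · have hpr : p.Prime := hp.out
    have hdvd : ∀ m ∈ P.support, ∀ i, p ∣ m i := fun m hm i =>
      (CharP.cast_eq_zero_iff K p (m i)).1 (natCast_eq_zero_of_pderiv_eq_zero (h i) hm)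
    obtain ⟨Q, hQ, hQdeg⟩ := exists_pow_eq_of_dvd_exponents hdvd
    refine ⟨Q, ?_, lt_of_le_of_lt hQdeg (Nat.div_lt_self hdeg hpr.one_lt), fun x hx => ?_⟩
    · rintro rfl
      rw [zero_pow hpr.ne_zero] at hQ
      exact hP hQ.symm
    · rw [← hQ, map_pow] at hx
      exact pow_eq_zero_iff hpr.ne_zero |>.1 hx

end Frobenius

section Main

variable {K : Type*} [Field K] {n : ℕ}

/-- **Key step of the proof of Theorem 3.3** (over an algebraically closed field): if `J` is a
nonempty finite set of joints of `L` with `|J| < C(d + n, n)`, then some member of `L` contains at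
most `d` points of `J`.  Printed argument: otherwise take `P ≠ 0` of minimal degree vanishing on
`J` (Lemma 1.4, here `FiniteFieldKakeya.exists_mvPolynomial_eval_eq_zero`); every line of `L`
through a point of `J` meets `Z(P)` in more than `deg P` points, so is contained in it (Lemma 1.6,
here `Extremal.aeval_line_eq_zero_of_totalDegree_lt_card`); at a joint the `n` independent
directions force `∇P = 0` (Lemma 3.2); each `∂ᵢ P` has smaller degree and vanishes on `J`, so
`∂ᵢ P = 0` by minimality; then `P = Q^p` (Frobenius), and `Q` contradicts minimality.
[cite: Tao2014PolynomialMethodSurvey, Thm 3.3 (proof, arXiv:1310.6482v5 pp. 14–15)] -/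
theorem exists_mem_ncard_inter_le [IsAlgClosed K] (L : Finset (Set (Fin n → K)))
    (J : Finset (Fin n → K)) (hJ : ∀ p ∈ J, IsJoint L p) (hne : J.Nonempty) {d : ℕ}
    (hd : J.card < (d + n).choose n) : ∃ ℓ ∈ L, ((J : Set (Fin n → K)) ∩ ℓ).ncard ≤ d := by
  classical
  by_contra! hcon
  -- a nonzero polynomial of minimal total degree vanishing on `J`
  have hex : ∃ e, ∃ P : MvPolynomial (Fin n) K, P ≠ 0 ∧ P.totalDegree ≤ e ∧
      ∀ x ∈ J, eval x P = 0 :=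
    ⟨d, FiniteFieldKakeya.exists_mvPolynomial_eval_eq_zero J d hd⟩
  obtain ⟨P, hP0, hPdeg, hPJ⟩ := Nat.find_spec hex
  have hmin : ∀ Q : MvPolynomial (Fin n) K, Q ≠ 0 → (∀ x ∈ J, eval x Q = 0) →
      P.totalDegree ≤ Q.totalDegree := fun Q hQ0 hQJ =>
    hPdeg.trans (Nat.find_min' hex ⟨Q, hQ0, le_rfl, hQJ⟩)
  have hPd : P.totalDegree ≤ d :=
    hPdeg.trans (Nat.find_min' hex (FiniteFieldKakeya.exists_mvPolynomial_eval_eq_zero J d hd))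
  -- `P` vanishes identically on every line of `L` through a point of `J`
  have hvan : ∀ p ∈ J, ∀ {w : Fin n → K}, w ≠ 0 → line K p w ∈ L →
      aeval (lineSubst p w) P = 0 := by
    intro p _ w hw hwL
    have hinj : Function.Injective fun t : K => p + t • w := line_injective p hw
    set s : Set K := (fun t : K => p + t • w) ⁻¹' (J : Set (Fin n → K)) with hs
    have hsfin : s.Finite := J.finite_toSet.preimage hinj.injOn
    have himage : (fun t : K => p + t • w) '' s = (J : Set (Fin n → K)) ∩ line K p w := by
      ext x
      constructor
      · rintro ⟨t, ht, rfl⟩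
        exact ⟨ht, t, rfl⟩
      · rintro ⟨hx, t, rfl⟩
        exact ⟨t, hx, rfl⟩
    have hcard : d < hsfin.toFinset.card := by
      have := hcon _ hwL
      rwa [← himage, Set.ncard_image_of_injective _ hinj, Set.ncard_eq_toFinset_card _ hsfin]
        at this
    refine Extremal.aeval_line_eq_zero_of_totalDegree_lt_card p w P hsfin.toFinset
      (lt_of_le_of_lt hPd hcard) fun t ht => hPJ _ ?_
    simpa [Set.Finite.mem_toFinset, hs] using ht
  -- hence `∇P` vanishes on `J`
  have hgrad : ∀ p ∈ J, ∀ i, eval p (pderiv i P) = 0 := by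
    intro p hp i
    obtain ⟨v, hv, hvL⟩ := hJ p hp
    exact eval_pderiv_eq_zero_of_linearIndependent hv
      (fun j => hvan p hp (hv.ne_zero j) (hvL j)) i
  -- `P` is not constant
  have hdegpos : 0 < P.totalDegree := by
    rw [Nat.pos_iff_ne_zero]
    intro h0
    obtain ⟨x₀, hx₀⟩ := hne
    have hC := totalDegree_eq_zero_iff_eq_C.1 h0
    have h1 := hPJ x₀ hx₀
    rw [hC, eval_C] at h1
    apply hP0
    rw [hC, h1, C_0]
  -- all first-order partial derivatives vanish identically, by minimality
  have hpd : ∀ i, pderiv i P = 0 := by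
    intro i
    by_contra hi
    have hlt := totalDegree_pderiv_lt hi
    have hle := hmin (pderiv i P) hi (fun x hx => hgrad x hx i)
    omega
  -- so `P = Q^p` with `Q` of smaller degree vanishing on `J`: contradiction
  obtain ⟨Q, hQ0, hQlt, hQzero⟩ := exists_totalDegree_lt_of_pderiv_eq_zero hP0 hdegpos hpd
  have := hmin Q hQ0 (fun x hx => hQzero x (hPJ x hx))
  omega

/-- **The iteration** ("If there is a line `ℓ` in `L′` that passes through `d` or fewer points
of `J′`, then we delete those points from `J′` and delete `ℓ` from `L′` … each line removes at
most `d` points"), over an algebraically closed field: if `|joints L| < C(d + n, n)` then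
`|joints L| ≤ |L| · d`.  By induction on `|L|`, removing a member with at most `d` joints on it
(`exists_mem_ncard_inter_le`); a joint off the removed line stays a joint of the rest.
[cite: Tao2014PolynomialMethodSurvey, Thm 3.3 (proof, arXiv:1310.6482v5 pp. 14–15)] -/
theorem ncard_joints_le_card_mul [IsAlgClosed K] (hn : 2 ≤ n) (L : Finset (Set (Fin n → K)))
    {d : ℕ} (hd : (joints L).ncard < (d + n).choose n) : (joints L).ncard ≤ L.card * d := by
  classical
  suffices H : ∀ (N : ℕ) (L : Finset (Set (Fin n → K))), L.card = N →
      (joints L).ncard < (d + n).choose n → (joints L).ncard ≤ N * d from H _ L rfl hd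
  intro N
  induction N with
  | zero =>
    intro L hL _
    rw [Finset.card_eq_zero] at hL
    subst hL
    have h0 : joints (∅ : Finset (Set (Fin n → K))) = ∅ := by
      ext p
      simp only [mem_joints_iff, IsJoint, Set.mem_empty_iff_false, iff_false, not_exists, not_and,
        not_forall]
      exact fun v _ => ⟨⟨0, by omega⟩, Finset.notMem_empty _⟩
    simp [h0]
  | succ N ih =>
    intro L hL hlt
    have hfin := joints_finite hn L
    rcases (joints L).eq_empty_or_nonempty with h0 | hne
    · simp [h0]
    have hJmem : ∀ p ∈ hfin.toFinset, IsJoint L p := fun p hp =>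
      (Set.Finite.mem_toFinset hfin).1 hp
    have hJne : hfin.toFinset.Nonempty := by simpa using hne
    have hJcard : hfin.toFinset.card < (d + n).choose n := by
      rwa [← Set.ncard_eq_toFinset_card _ hfin]
    obtain ⟨ℓ, hℓL, hℓ⟩ := exists_mem_ncard_inter_le L hfin.toFinset hJmem hJne hJcard
    rw [Set.Finite.coe_toFinset] at hℓ
    have hsub : joints L ⊆ joints (L.erase ℓ) ∪ (joints L ∩ ℓ) := by
      intro p hp
      by_cases hpℓ : p ∈ ℓ
      · exact Or.inr ⟨hp, hpℓ⟩
      · exact Or.inl (IsJoint.erase hp hpℓ)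
    have hmono : joints (L.erase ℓ) ⊆ joints L := joints_mono (Finset.erase_subset ℓ L)
    have hcard' : (L.erase ℓ).card = N := by
      rw [Finset.card_erase_of_mem hℓL, hL, Nat.add_sub_cancel]
    have ih' := ih (L.erase ℓ) hcard' (lt_of_le_of_lt (Set.ncard_le_ncard hmono hfin) hlt)
    calc (joints L).ncard ≤ (joints (L.erase ℓ) ∪ (joints L ∩ ℓ)).ncard :=
          Set.ncard_le_ncard hsub ((hfin.subset hmono).union (hfin.subset Set.inter_subset_left))
      _ ≤ (joints (L.erase ℓ)).ncard + (joints L ∩ ℓ).ncard := Set.ncard_union_le _ _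
      _ ≤ N * d + d := add_le_add ih' hℓ
      _ = (N + 1) * d := by ring

/-- **Theorem 3.3 over an algebraically closed field, in integers**: for `n ≥ 2` and any finite
family `L` of subsets of `Kⁿ`, `|joints L|^{n−1} ≤ n! · |L|ⁿ`.  (Printed: "for any `d`, one of
`|J| ≤ d|L|` and `|J| > dⁿ/n!` must hold"; here `d` is the least integer with `C(d + n, n) > |J|`,
for which `dⁿ ≤ d (d+1) ⋯ (d+n−1) = n! C(d−1+n, n) ≤ n! |J|`.)
[cite: Tao2014PolynomialMethodSurvey, Thm 3.3 (arXiv:1310.6482v5 p. 14)] -/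
theorem ncard_joints_pow_le_of_isAlgClosed [IsAlgClosed K] (hn : 2 ≤ n)
    (L : Finset (Set (Fin n → K))) : (joints L).ncard ^ (n - 1) ≤ n.factorial * L.card ^ n := by
  classical
  set m := (joints L).ncard with hm
  rcases Nat.eq_zero_or_pos m with h0 | hmpos
  · rw [h0, zero_pow (by omega)]
    exact Nat.zero_le _
  have hex : ∃ d, m < (d + n).choose n := by
    refine ⟨m, ?_⟩
    calc m < m + 1 := Nat.lt_succ_self m
      _ = (m + 1).choose m := (Nat.choose_succ_self_right m).symm
      _ ≤ (m + n).choose m := Nat.choose_le_choose m (by omega)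
      _ = (m + n).choose n := Nat.choose_symm_add
  obtain ⟨d, hd, hdmin⟩ : ∃ d, m < (d + n).choose n ∧ ∀ e < d, (e + n).choose n ≤ m :=
    ⟨Nat.find hex, Nat.find_spec hex, fun e he => not_lt.1 (Nat.find_min hex he)⟩
  have hd0 : d ≠ 0 := by
    rintro rfl
    rw [zero_add, Nat.choose_self] at hd
    omega
  obtain ⟨e, rfl⟩ := Nat.exists_eq_succ_of_ne_zero hd0
  have hB : m ≤ L.card * (e + 1) := ncard_joints_le_card_mul hn L hd
  have hdn : (e + 1) ^ n ≤ n.factorial * m :=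
    calc (e + 1) ^ n ≤ (e + 1).ascFactorial n := Nat.pow_succ_le_ascFactorial _ _
      _ = n.factorial * (e + n).choose n := Nat.ascFactorial_eq_factorial_mul_choose e n
      _ ≤ n.factorial * m := Nat.mul_le_mul_left _ (hdmin e (Nat.lt_succ_self e))
  have key : m ^ (n - 1) * m ≤ n.factorial * L.card ^ n * m :=
    calc m ^ (n - 1) * m = m ^ n := by rw [← pow_succ, Nat.sub_add_cancel (by omega)]
      _ ≤ (L.card * (e + 1)) ^ n := Nat.pow_le_pow_left hB n
      _ = L.card ^ n * (e + 1) ^ n := mul_pow _ _ _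
      _ ≤ L.card ^ n * (n.factorial * m) := Nat.mul_le_mul_left _ hdn
      _ = n.factorial * L.card ^ n * m := by ring
  exact Nat.le_of_mul_le_mul_right key hmpos

end Main

section AnyField

variable {F : Type*} [Field F] {n : ℕ}

/-- **Theorem 3.3 (Joints conjecture; Guth–Katz, Kaplan–Sharir–Shustin, Quilodrán, in Tao's
arbitrary-field form), in integers.**  Let `F` be ANY field, `n ≥ 2`, and `L` a finite family of
subsets of `Fⁿ` (for the theorem as printed: a set of `N` lines); then the number `|J|` of joints
of `L` — points through which pass `n` lines of `L` not all in a hyperplane — satisfies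
`|J|^{n−1} ≤ n! · |L|ⁿ`.  (Members of `L` that are not lines are never among the `n` lines at a
joint, so they only weaken the bound; no hypothesis on `L` is needed.)  Reduction to the
algebraically closed case: extend scalars to an algebraic closure `K ⊇ F`; a line of `Fⁿ` spans a
line of `Kⁿ`, joints map injectively to joints (linear independence is a nonvanishing
determinant), and the number of lines does not increase.
[cite: Tao2014PolynomialMethodSurvey, Thm 3.3 (arXiv:1310.6482v5 p. 14)] -/
theorem ncard_joints_pow_le (hn : 2 ≤ n) (L : Finset (Set (Fin n → F))) :
    (joints L).ncard ^ (n - 1) ≤ n.factorial * L.card ^ n := by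
  classical
  let K := AlgebraicClosure F
  let ι : F →+* K := algebraMap F K
  have hι : Function.Injective ι := ι.injective
  let φ : (Fin n → F) → (Fin n → K) := fun x i => ι (x i)
  have hφ : Function.Injective φ := fun x y h => funext fun i => hι (congrFun h i)
  -- the `K`-line spanned by (the image of) an `F`-line
  let Λ : Set (Fin n → F) → Set (Fin n → K) := fun ℓ =>
    {z | ∃ x ∈ ℓ, ∃ y ∈ ℓ, ∃ t : K, z = φ x + t • (φ y - φ x)}
  have hΛ : ∀ x w : Fin n → F, Λ (line F x w) = line K (φ x) (φ w) := by
    intro x w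
    ext z
    constructor
    · rintro ⟨_, ⟨s, rfl⟩, _, ⟨s', rfl⟩, t, rfl⟩
      refine ⟨ι s + t * (ι s' - ι s), ?_⟩
      ext i
      simp only [φ, Pi.add_apply, Pi.smul_apply, Pi.sub_apply, smul_eq_mul, map_add, map_mul]
      ring
    · rintro ⟨t, rfl⟩
      refine ⟨x, mem_line_self x w, x + w, add_mem_line x w, t, ?_⟩
      ext i
      simp only [φ, Pi.add_apply, Pi.smul_apply, Pi.sub_apply, smul_eq_mul, map_add]
      ring
  let LK : Finset (Set (Fin n → K)) := L.image Λ
  have hcardK : LK.card ≤ L.card := Finset.card_image_le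
  have hmaps : ∀ p ∈ joints L, φ p ∈ joints LK := by
    rintro p ⟨v, hv, hvL⟩
    refine ⟨fun i => φ (v i), ?_, fun i => Finset.mem_image.2 ⟨line F p (v i), hvL i, hΛ p (v i)⟩⟩
    have hdet : (Matrix.of v).det ≠ 0 := by
      have hu : IsUnit (Matrix.of v) := Matrix.linearIndependent_rows_iff_isUnit.1 hv
      exact ((Matrix.isUnit_iff_isUnit_det _).1 hu).ne_zero
    have hmap : (Matrix.of fun i => φ (v i)) = ι.mapMatrix (Matrix.of v) := by
      ext i j
      rfl
    have hdetK : (Matrix.of fun i => φ (v i)).det ≠ 0 := by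
      rw [hmap, ← RingHom.map_det]
      exact (map_ne_zero ι).2 hdet
    exact Matrix.linearIndependent_rows_iff_isUnit.2
      ((Matrix.isUnit_iff_isUnit_det _).2 (isUnit_iff_ne_zero.2 hdetK))
  have hle : (joints L).ncard ≤ (joints LK).ncard :=
    Set.ncard_le_ncard_of_injOn φ hmaps hφ.injOn (joints_finite hn LK)
  calc (joints L).ncard ^ (n - 1) ≤ (joints LK).ncard ^ (n - 1) := Nat.pow_le_pow_left hle _
    _ ≤ n.factorial * LK.card ^ n := ncard_joints_pow_le_of_isAlgClosed hn LK
    _ ≤ n.factorial * L.card ^ n := Nat.mul_le_mul_left _ (Nat.pow_le_pow_left hcardK _)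

/-- `n! ≤ n^{n−1}` ("using the trivial bound `n! ≤ n^{n−1}`", last line of the printed proof).
[cite: Tao2014PolynomialMethodSurvey, Thm 3.3 (proof, arXiv:1310.6482v5 p. 15)] -/
theorem factorial_le_pow_pred : ∀ n : ℕ, n.factorial ≤ n ^ (n - 1)
  | 0 => by simp
  | 1 => by simp
  | (k + 2) => by
    rw [Nat.factorial_succ, show k + 2 - 1 = k + 1 from rfl, pow_succ']
    refine Nat.mul_le_mul_left _ ((factorial_le_pow_pred (k + 1)).trans ?_)
    exact Nat.pow_le_pow_left (by omega) _

/-- **Theorem 3.3 (Joints conjecture), exactly as printed: "Let `F` be a field, let `n ≥ 2`, and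
let `L` be a set of `N` lines in `Fⁿ`. … Then the number of joints is at most `n N^{n/(n−1)}`."**
(From `ncard_joints_pow_le` and `n! ≤ n^{n−1}`, taking `(n−1)`-th roots.)
[cite: Tao2014PolynomialMethodSurvey, Thm 3.3 (arXiv:1310.6482v5 p. 14)] -/
theorem ncard_joints_le (hn : 2 ≤ n) (L : Finset (Set (Fin n → F))) :
    ((joints L).ncard : ℝ) ≤ n * (L.card : ℝ) ^ ((n : ℝ) / (n - 1)) := by
  have h' : ((joints L).ncard : ℝ) ^ (n - 1) ≤ (n : ℝ) ^ (n - 1) * (L.card : ℝ) ^ n := by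
    have := (ncard_joints_pow_le hn L).trans
      (Nat.mul_le_mul_right _ (factorial_le_pow_pred n))
    exact_mod_cast this
  have hm0 : (0 : ℝ) ≤ (joints L).ncard := Nat.cast_nonneg _
  have hN0 : (0 : ℝ) ≤ L.card := Nat.cast_nonneg _
  have hn1 : (n - 1 : ℕ) ≠ 0 := by omega
  have hz : (0 : ℝ) ≤ ((n - 1 : ℕ) : ℝ)⁻¹ := by positivity
  have key := Real.rpow_le_rpow (pow_nonneg hm0 _) h' hz
  rw [Real.pow_rpow_inv_natCast hm0 hn1,
    Real.mul_rpow (pow_nonneg (Nat.cast_nonneg _) _) (pow_nonneg hN0 _),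
    Real.pow_rpow_inv_natCast (Nat.cast_nonneg _) hn1, ← Real.rpow_natCast (L.card : ℝ) n,
    ← Real.rpow_mul hN0] at key
  convert key using 3
  rw [Nat.cast_sub (by omega), Nat.cast_one, div_eq_mul_inv]

end AnyField

section Sharpness

/-! ### Sharpness of Theorem 3.3: the lines in the coordinate directions through a grid

The sentence after Theorem 3.3 (arXiv v5 p. 14), verbatim: "The bound here is sharp except for
the constant factor of `n`, as can be seen by considering the lines in the coordinate directions
`e_1, …, e_n` passing through a Cartesian product `A_1 × … × A_n`, where each `A_1, …, A_n` is a
finite subset of `F` of cardinality comparable to `N^{1/(n−1)}`."  Formalized: for finite sets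
`A i ⊆ F` (`i : Fin n`) the family `gridLines A` of the lines `{x + t eᵢ : t ∈ F}`, `x` in the
grid `∏ᵢ A i` (`Fintype.piFinset A`), consists of lines (`isLine_of_mem_gridLines`), has at most
`∑ᵢ ∏_{j ≠ i} |A j|` members (`card_gridLines_le`), and — for `n ≥ 2` — its joints are EXACTLY
the grid points (`joints_gridLines`), `∏ᵢ |A i|` of them (`ncard_joints_gridLines`).  With
`A i = A` of size `m` for every `i`: at most `n m^{n−1}` lines and exactly `mⁿ` joints
(`card_gridLines_const_le`, `ncard_joints_gridLines_const`), so that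
`Nⁿ ≤ nⁿ · |J|^{n−1}` (`card_gridLines_pow_le`) — to be compared with `|J|^{n−1} ≤ n! · Nⁿ`
(`ncard_joints_pow_le`) — i.e. `|J| ≥ n^{−n/(n−1)} N^{n/(n−1)}` (`rpow_card_gridLines_le`)
against the theorem's `|J| ≤ n N^{n/(n−1)}`.
-/

variable {F : Type*} [Field F] {n : ℕ}

open scoped Classical in
/-- **The lines in the coordinate directions `e₁, …, eₙ` passing through the Cartesian product
`A₁ × ⋯ × Aₙ`** (the sharpness example after Theorem 3.3): the finite family of the lines
`{x + t eᵢ : t ∈ F}` with `x ∈ ∏ᵢ Aᵢ` and `i = 1, …, n`.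
[cite: Tao2014PolynomialMethodSurvey, remark after Thm 3.3 (arXiv:1310.6482v5 p. 14)] -/
noncomputable def gridLines (A : Fin n → Finset F) : Finset (Set (Fin n → F)) :=
  Finset.univ.biUnion fun i : Fin n =>
    (Fintype.piFinset A).image fun x : Fin n → F => line F x (Pi.single i 1)

/-- Membership in `gridLines A`: the members are the lines `line F x eᵢ`, `x` a grid point.
[cite: Tao2014PolynomialMethodSurvey, remark after Thm 3.3 (arXiv:1310.6482v5 p. 14)] -/
theorem mem_gridLines_iff {A : Fin n → Finset F} {ℓ : Set (Fin n → F)} :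
    ℓ ∈ gridLines A ↔
      ∃ i : Fin n, ∃ x ∈ Fintype.piFinset A, line F x (Pi.single i 1) = ℓ := by
  classical
  simp only [gridLines, Finset.mem_biUnion, Finset.mem_univ, true_and, Finset.mem_image]

/-- The coordinate vector `eᵢ` is nonzero. [folklore] -/
private theorem single_one_ne_zero (i : Fin n) : (Pi.single i 1 : Fin n → F) ≠ 0 := by
  intro h
  simpa using congrFun h i

/-- Every member of `gridLines A` is a line (so the family is "a set of `N` lines in `Fⁿ`" as in
Theorem 3.3). [cite: Tao2014PolynomialMethodSurvey, remark after Thm 3.3 (arXiv:1310.6482v5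
p. 14)] -/
theorem isLine_of_mem_gridLines {A : Fin n → Finset F} {ℓ : Set (Fin n → F)}
    (hℓ : ℓ ∈ gridLines A) : IsLine ℓ := by
  obtain ⟨i, x, -, rfl⟩ := mem_gridLines_iff.1 hℓ
  exact isLine_line x (single_one_ne_zero i)

/-- Off the `i`-th coordinate, the points of the line `{x + t eᵢ}` agree with `x`. [folklore] -/
private theorem apply_eq_of_mem_line_single {x p : Fin n → F} {i k : Fin n}
    (hp : p ∈ line F x (Pi.single i 1)) (hk : k ≠ i) : p k = x k := by
  obtain ⟨t, rfl⟩ := mem_line_iff.1 hp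
  simp [hk]

/-- Re-basing an axis-parallel line at the point of the line whose `i`-th coordinate vanishes.
[folklore] -/
private theorem line_update_zero (x : Fin n → F) (i : Fin n) :
    line F (Function.update x i 0) (Pi.single i 1) = line F x (Pi.single i 1) := by
  apply line_eq_of_mem
  refine ⟨-x i, ?_⟩
  ext k
  by_cases hk : k = i
  · subst hk
    simp
  · simp [hk]

/-- **The number of lines: `|gridLines A| ≤ ∑ᵢ ∏_{j ≠ i} |A j|`** (the lines in direction `eᵢ`
through the grid are the lines `{y + t eᵢ}` with `y_j ∈ A_j` for `j ≠ i` and `y_i = 0`).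
[cite: Tao2014PolynomialMethodSurvey, remark after Thm 3.3 (arXiv:1310.6482v5 p. 14)] -/
theorem card_gridLines_le (A : Fin n → Finset F) :
    (gridLines A).card ≤ ∑ i, ∏ j ∈ Finset.univ.erase i, (A j).card := by
  classical
  refine Finset.card_biUnion_le.trans (Finset.sum_le_sum fun i _ => ?_)
  have hsub : ((Fintype.piFinset A).image fun x : Fin n → F => line F x (Pi.single i 1)) ⊆
      (Fintype.piFinset (Function.update A i {0})).image
        fun y : Fin n → F => line F y (Pi.single i 1) := by
    intro ℓ hℓ
    obtain ⟨x, hx, rfl⟩ := Finset.mem_image.1 hℓ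
    refine Finset.mem_image.2 ⟨Function.update x i 0, ?_, line_update_zero x i⟩
    refine Fintype.mem_piFinset.2 fun j => ?_
    by_cases hj : j = i
    · subst hj
      simp
    · rw [Function.update_of_ne hj, Function.update_of_ne hj]
      exact Fintype.mem_piFinset.1 hx j
  calc ((Fintype.piFinset A).image fun x : Fin n → F => line F x (Pi.single i 1)).card
      ≤ ((Fintype.piFinset (Function.update A i {0})).image
          fun y : Fin n → F => line F y (Pi.single i 1)).card := Finset.card_le_card hsub
    _ ≤ (Fintype.piFinset (Function.update A i {0})).card := Finset.card_image_le
    _ = ∏ j, (Function.update A i {0} j).card := Fintype.card_piFinset _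
    _ = ∏ j ∈ Finset.univ.erase i, (A j).card := by
      rw [← Finset.mul_prod_erase Finset.univ _ (Finset.mem_univ i), Function.update_self,
        Finset.card_singleton, one_mul]
      exact Finset.prod_congr rfl fun j hj => by
        rw [Function.update_of_ne (Finset.ne_of_mem_erase hj)]

/-- **Every grid point is a joint** of `gridLines A`: the `n` lines `{x + t eᵢ}` of the family pass
through `x` and their directions `e₁, …, eₙ` are linearly independent.
[cite: Tao2014PolynomialMethodSurvey, remark after Thm 3.3 (arXiv:1310.6482v5 p. 14)] -/
theorem isJoint_gridLines {A : Fin n → Finset F} {x : Fin n → F}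
    (hx : x ∈ Fintype.piFinset A) : IsJoint (gridLines A) x := by
  classical
  exact ⟨fun i => Pi.single i 1, Pi.linearIndependent_single_one (Fin n) F,
    fun i => mem_gridLines_iff.2 ⟨i, x, hx, rfl⟩⟩

/-- The grid is contained in the set of joints of `gridLines A`.
[cite: Tao2014PolynomialMethodSurvey, remark after Thm 3.3 (arXiv:1310.6482v5 p. 14)] -/
theorem piFinset_subset_joints (A : Fin n → Finset F) :
    (↑(Fintype.piFinset A) : Set (Fin n → F)) ⊆ joints (gridLines A) :=
  fun _ hx => isJoint_gridLines (Finset.mem_coe.1 hx)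

/-- Conversely (`n ≥ 2`), **every joint of `gridLines A` is a grid point**: the `n` lines of the
family through a joint `p` are axis-parallel with pairwise non-proportional directions, so they
use every coordinate direction; a line of the family in direction `eⱼ` through `p` shows
`p_k ∈ A_k` for all `k ≠ j`, and two different `j` cover every `k`. [folklore] -/
private theorem mem_piFinset_of_isJoint (hn : 2 ≤ n) {A : Fin n → Finset F} {p : Fin n → F}
    (hp : IsJoint (gridLines A) p) : p ∈ Fintype.piFinset A := by
  obtain ⟨v, hv, hL⟩ := hp
  have key : ∀ i, ∃ j : Fin n, (∃ c : F, v i = c • Pi.single j 1) ∧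
      ∀ k, k ≠ j → p k ∈ A k := by
    intro i
    obtain ⟨j, x, hx, hℓ⟩ := mem_gridLines_iff.1 (hL i)
    have hpx : p ∈ line F x (Pi.single j 1) := hℓ ▸ mem_line_self p (v i)
    refine ⟨j, ?_, fun k hk => ?_⟩
    · have h1 : line F p (Pi.single j 1) = line F p (v i) := by rw [line_eq_of_mem hpx, hℓ]
      obtain ⟨c, -, hc⟩ := exists_eq_smul_of_line_eq (hv.ne_zero i) h1
      exact ⟨c, hc⟩
    · rw [apply_eq_of_mem_line_single hpx hk]
      exact Fintype.mem_piFinset.1 hx k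
  choose j hj using key
  have hinj : Function.Injective j := by
    intro i i' h
    by_contra hii
    obtain ⟨c, hc⟩ := (hj i).1
    obtain ⟨c', hc'⟩ := (hj i').1
    have hc0 : c ≠ 0 := by
      rintro rfl
      exact hv.ne_zero i (by rw [hc, zero_smul])
    refine ne_smul_of_linearIndependent hv hii (c' / c) ?_
    rw [hc, hc', h, smul_smul, div_mul_cancel₀ c' hc0]
  have hsurj : Function.Surjective j := Finite.surjective_of_injective hinj
  haveI : Nontrivial (Fin n) := Fin.nontrivial_iff_two_le.2 hn
  refine Fintype.mem_piFinset.2 fun k => ?_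
  obtain ⟨k', hk'⟩ := exists_ne k
  obtain ⟨i, hi⟩ := hsurj k'
  exact (hj i).2 k (by rw [hi]; exact hk'.symm)

/-- **For `n ≥ 2` the joints of `gridLines A` are exactly the points of the grid `A₁ × ⋯ × Aₙ`.**
[cite: Tao2014PolynomialMethodSurvey, remark after Thm 3.3 (arXiv:1310.6482v5 p. 14)] -/
theorem joints_gridLines (hn : 2 ≤ n) (A : Fin n → Finset F) :
    joints (gridLines A) = ↑(Fintype.piFinset A) :=
  Set.Subset.antisymm (fun _ hp => Finset.mem_coe.2 (mem_piFinset_of_isJoint hn hp))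
    (piFinset_subset_joints A)

/-- **The number of joints of `gridLines A` is `∏ᵢ |A i|`** (`n ≥ 2`).
[cite: Tao2014PolynomialMethodSurvey, remark after Thm 3.3 (arXiv:1310.6482v5 p. 14)] -/
theorem ncard_joints_gridLines (hn : 2 ≤ n) (A : Fin n → Finset F) :
    (joints (gridLines A)).ncard = ∏ i, (A i).card := by
  rw [joints_gridLines hn, Set.ncard_coe_finset, Fintype.card_piFinset]

/-- Equal factors `A₁ = ⋯ = Aₙ = A`, `|A| = m`: **at most `n m^{n−1}` lines.**
[cite: Tao2014PolynomialMethodSurvey, remark after Thm 3.3 (arXiv:1310.6482v5 p. 14)] -/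
theorem card_gridLines_const_le (A : Finset F) :
    (gridLines fun _ : Fin n => A).card ≤ n * A.card ^ (n - 1) := by
  refine (card_gridLines_le _).trans (le_of_eq ?_)
  have h : ∀ i : Fin n, ∏ _j ∈ Finset.univ.erase i, A.card = A.card ^ (n - 1) := fun i => by
    rw [Finset.prod_const, Finset.card_erase_of_mem (Finset.mem_univ i), Finset.card_univ,
      Fintype.card_fin]
  simp only [h, Finset.sum_const, Finset.card_univ, Fintype.card_fin, smul_eq_mul]

/-- Equal factors `A₁ = ⋯ = Aₙ = A`, `|A| = m`, `n ≥ 2`: **exactly `mⁿ` joints.**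
[cite: Tao2014PolynomialMethodSurvey, remark after Thm 3.3 (arXiv:1310.6482v5 p. 14)] -/
theorem ncard_joints_gridLines_const (hn : 2 ≤ n) (A : Finset F) :
    (joints (gridLines fun _ : Fin n => A)).ncard = A.card ^ n := by
  rw [ncard_joints_gridLines hn, Finset.prod_const, Finset.card_univ, Fintype.card_fin]

/-- **Sharpness of Theorem 3.3 up to the constant, in integers:** for the `N ≤ n m^{n−1}` lines
`gridLines (fun _ => A)` (`|A| = m`, `n ≥ 2`) and their `|J| = mⁿ` joints,
`Nⁿ ≤ nⁿ · |J|^{n−1}` — against `|J|^{n−1} ≤ n! · Nⁿ` for every family (`ncard_joints_pow_le`).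
[cite: Tao2014PolynomialMethodSurvey, remark after Thm 3.3 (arXiv:1310.6482v5 p. 14)] -/
theorem card_gridLines_pow_le (hn : 2 ≤ n) (A : Finset F) :
    (gridLines fun _ : Fin n => A).card ^ n ≤
      n ^ n * (joints (gridLines fun _ : Fin n => A)).ncard ^ (n - 1) := by
  rw [ncard_joints_gridLines_const hn, ← pow_mul, Nat.mul_comm n (n - 1), pow_mul, ← mul_pow]
  exact Nat.pow_le_pow_left (card_gridLines_const_le A) n

/-- **Sharpness of Theorem 3.3 up to the constant, as printed ("sharp except for the constant
factor of `n`"):** the family `gridLines (fun _ => A)` of `N` lines has at least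
`n^{−n/(n−1)} N^{n/(n−1)}` joints, i.e. `N^{n/(n−1)} ≤ n^{n/(n−1)} · |J|`, whereas every family
of `N` lines has at most `n N^{n/(n−1)}` joints (`ncard_joints_le`).  Over a field with at least
`m` elements this provides, for every `m`, `N ≤ n m^{n−1}` lines with `mⁿ` joints.
[cite: Tao2014PolynomialMethodSurvey, remark after Thm 3.3 (arXiv:1310.6482v5 p. 14)] -/
theorem rpow_card_gridLines_le (hn : 2 ≤ n) (A : Finset F) :
    ((gridLines fun _ : Fin n => A).card : ℝ) ^ ((n : ℝ) / (n - 1)) ≤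
      (n : ℝ) ^ ((n : ℝ) / (n - 1)) * (joints (gridLines fun _ : Fin n => A)).ncard := by
  have hN : ((gridLines fun _ : Fin n => A).card : ℝ) ≤ n * (A.card : ℝ) ^ (n - 1) := by
    exact_mod_cast card_gridLines_const_le (n := n) A
  have hn1 : ((n : ℝ) - 1) ≠ 0 := by
    have : (2 : ℝ) ≤ n := by exact_mod_cast hn
    linarith
  have hz : (0 : ℝ) ≤ (n : ℝ) / (n - 1) := by
    have : (2 : ℝ) ≤ n := by exact_mod_cast hn
    exact div_nonneg (Nat.cast_nonneg _) (by linarith)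
  have key := Real.rpow_le_rpow (Nat.cast_nonneg _) hN hz
  rw [Real.mul_rpow (Nat.cast_nonneg _) (pow_nonneg (Nat.cast_nonneg _) _),
    ← Real.rpow_natCast (A.card : ℝ) (n - 1), ← Real.rpow_mul (Nat.cast_nonneg _),
    Nat.cast_sub (by omega : 1 ≤ n), Nat.cast_one, mul_div_cancel₀ _ hn1,
    Real.rpow_natCast] at key
  rw [ncard_joints_gridLines_const hn, Nat.cast_pow]
  exact key

end Sharpness

end Joints

end Literature.Combinatorics.Kakeya
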